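import Literature.Probability.LatticeModels.PlaneRotatorBoxBlockReduction
import Literature.Probability.LatticeModels.PlaneRotatorBoxSymmetry
import HarnessLib

/-!
# Lieb's number of the two-dimensional XY model at `R = 2`, explicitly: `S_2(K) = u(K)·(4G_e + 8G_c)` on the free
# `3 × 3` block, and `χ^{int}_2(K) = 1 + 4G_e + 4G_c`

E. H. Lieb, Comm. Math. Phys. **77** (1980) 127 [Lieb1980], Theorem 4 and p. 128 (boxes: "one can, in principle, compute
`β_c` to arbitrary accuracy by taking `B` to be the boundary of a sufficiently large box"). The tree reduces Lieb's number of
the shell-free box of radius `R + 1` to two-point functions of the FREE block of radius `R` for every `ν`, `R`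
(`nnBoxShellSum_succ`, `boxInteriorSum_succ`, `PlaneRotatorBoxBlockReduction.lean`) and proves the hyperoctahedral
symmetry of the free block (`twoPoint_nnXY_box_refCentre_reflect/_perm`, `PlaneRotatorBoxSymmetry.lean`). This file
spells out the first non-trivial case `ν = 2`, `R + 1 = 2` — the number the `hubbard-tc` cell certifies
(K5-LIEB-BOX-R2: `S_2(0.663) < 1 < S_2(0.664)` ⇒ `T_c^{XY}(ℤ²) ≤ 1.5083 J`; layered slab numbers via `slabShellSum_le_box2D`):

* `blockEdge = (1,0)`, `blockCorner = (1,1)` in the `3 × 3` block `box 2 1`; `blockGe K = ⟨cos(θ_0 − θ_{(1,0)})⟩_{3×3,K}`,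
  `blockGc K = ⟨cos(θ_0 − θ_{(1,1)})⟩_{3×3,K}` (free boundary conditions, coupling `K` per bond);
* `twoPoint_block_eq_blockGe`, `twoPoint_block_eq_blockGc` — the eight boundary sites of the block take the two values
  `G_e` (edge midpoints) and `G_c` (corners);
* **`nnBoxShellSum_two_two`** — `S_2(K) = u(K)·(4G_e(K) + 8G_c(K))`, `u = I₁/I₀` (the twelve face sites of the `5 × 5` box hang
  on the block boundary: edge midpoints once, corners twice; the four corners of the `5 × 5` box are free rotators);
* **`boxInteriorSum_two`** — `χ^{int}_2(K) = 1 + 4G_e(K) + 4G_c(K)`.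

So the two INPUTS of the kernel criteria `twoPoint_nn_le_pow_boxShellSum` (`ν = 2`, `R = 2`) and `slabShellSum_le_box2D`
(`R = 2`) are explicit combinations of TWO nine-dimensional integrals `G_e`, `G_c` — exactly the quantities the cell's
certified character-expansion engine encloses (`pub/hubbard-tc/hubbard-tc-p2/s2_cert.py`); no hand step remains between the
kernel criterion and the certified enclosure. Classical comparison model only (K5); no numerics here.
-/

noncomputable section

open MeasureTheory Finset
open scoped BigOperators

namespace Literature.Probability.LatticeModels

namespace PlaneRotator

section ThreeByThree

open Literature.Barriers.CriticalPhenomena Literature.Barriers.CriticalPhenomena.LongRangeIsing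

/-- The edge-midpoint site `(1, 0)` of the `3 × 3` block `[−1, 1]²`. [cite: Lieb1980, p. 128 (boxes)] -/
def blockEdge : box 2 1 := ⟨![1, 0], by decide⟩

/-- The corner site `(1, 1)` of the `3 × 3` block `[−1, 1]²`. [cite: Lieb1980, p. 128 (boxes)] -/
def blockCorner : box 2 1 := ⟨![1, 1], by decide⟩

variable [MeasurableSpace Circle] [BorelSpace Circle]

/-- `G_e(K) = ⟨cos(θ_0 − θ_{(1,0)})⟩_{3×3, K}`: centre-to-edge-midpoint two-point function of the nearest-neighbour XY model on
the free `3 × 3` block at coupling `K`. [cite: Lieb1980, Theorem 4 and p. 128 (boxes)] -/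
def blockGe (K : ℝ) : ℝ := twoPoint (nnXYCoupling K 2 (box 2 1)) (refCentre 2 1) blockEdge

/-- `G_c(K) = ⟨cos(θ_0 − θ_{(1,1)})⟩_{3×3, K}`: centre-to-corner two-point function of the free `3 × 3` block.
[cite: Lieb1980, Theorem 4 and p. 128 (boxes)] -/
def blockGc (K : ℝ) : ℝ := twoPoint (nnXYCoupling K 2 (box 2 1)) (refCentre 2 1) blockCorner

/-- Two-point functions of the block agree on sites with equal coordinates. [folklore] -/
private theorem twoPoint_block_congr (K : ℝ) {x y : box 2 1} (h : (x : Site 2) = y) :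
    twoPoint (nnXYCoupling K 2 (box 2 1)) (refCentre 2 1) x = twoPoint (nnXYCoupling K 2 (box 2 1)) (refCentre 2 1) y := by
  rw [Subtype.ext h]

/-- **The eight boundary sites of the `3 × 3` block take two values**: `G(x) = G_e` for the edge midpoints
`(±1, 0), (0, ±1)`. [cite: Lieb1980, Theorem 4 and p. 128 (boxes)] -/
theorem twoPoint_block_eq_blockGe (K : ℝ) (x : box 2 1)
    (hx : (x : Site 2) = ![1, 0] ∨ (x : Site 2) = ![-1, 0] ∨ (x : Site 2) = ![0, 1] ∨ (x : Site 2) = ![0, -1]) :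
    twoPoint (nnXYCoupling K 2 (box 2 1)) (refCentre 2 1) x = blockGe K := by
  -- the three symmetry images of the edge midpoint
  have h10 : ∀ y : box 2 1, (y : Site 2) = ![1, 0] → twoPoint (nnXYCoupling K 2 (box 2 1)) (refCentre 2 1) y = blockGe K :=
    fun y hy => twoPoint_block_congr K (hy.trans (by rfl))
  have hm10 : ∀ y : box 2 1, (y : Site 2) = ![-1, 0] → twoPoint (nnXYCoupling K 2 (box 2 1)) (refCentre 2 1) y = blockGe K := by
    intro y hy
    rw [blockGe, ← twoPoint_nnXY_box_refCentre_reflect K blockEdge 0]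
    exact twoPoint_block_congr K (hy.trans (by decide))
  have h01 : ∀ y : box 2 1, (y : Site 2) = ![0, 1] → twoPoint (nnXYCoupling K 2 (box 2 1)) (refCentre 2 1) y = blockGe K := by
    intro y hy
    rw [blockGe, ← twoPoint_nnXY_box_refCentre_perm K blockEdge (Equiv.swap 0 1)]
    exact twoPoint_block_congr K (hy.trans (by decide))
  have h0m1 : ∀ y : box 2 1, (y : Site 2) = ![0, -1] → twoPoint (nnXYCoupling K 2 (box 2 1)) (refCentre 2 1) y = blockGe K := by
    intro y hy
    have h := twoPoint_nnXY_box_refCentre_reflect K (⟨![0, 1], by decide⟩ : box 2 1) 1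
    rw [h01 (⟨![0, 1], by decide⟩ : box 2 1) rfl] at h
    rw [← h]
    exact twoPoint_block_congr K (hy.trans (by decide))
  rcases hx with hx | hx | hx | hx
  · exact h10 x hx
  · exact hm10 x hx
  · exact h01 x hx
  · exact h0m1 x hx

/-- `G(x) = G_c` for the corners `(±1, ±1)` of the `3 × 3` block. [cite: Lieb1980, Theorem 4 and p. 128 (boxes)] -/
theorem twoPoint_block_eq_blockGc (K : ℝ) (x : box 2 1)
    (hx : (x : Site 2) = ![1, 1] ∨ (x : Site 2) = ![-1, 1] ∨ (x : Site 2) = ![1, -1] ∨ (x : Site 2) = ![-1, -1]) :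
    twoPoint (nnXYCoupling K 2 (box 2 1)) (refCentre 2 1) x = blockGc K := by
  have h11 : ∀ y : box 2 1, (y : Site 2) = ![1, 1] → twoPoint (nnXYCoupling K 2 (box 2 1)) (refCentre 2 1) y = blockGc K :=
    fun y hy => twoPoint_block_congr K (hy.trans (by rfl))
  have hm11 : ∀ y : box 2 1, (y : Site 2) = ![-1, 1] → twoPoint (nnXYCoupling K 2 (box 2 1)) (refCentre 2 1) y = blockGc K := by
    intro y hy
    rw [blockGc, ← twoPoint_nnXY_box_refCentre_reflect K blockCorner 0]
    exact twoPoint_block_congr K (hy.trans (by decide))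
  have h1m1 : ∀ y : box 2 1, (y : Site 2) = ![1, -1] → twoPoint (nnXYCoupling K 2 (box 2 1)) (refCentre 2 1) y = blockGc K := by
    intro y hy
    rw [blockGc, ← twoPoint_nnXY_box_refCentre_reflect K blockCorner 1]
    exact twoPoint_block_congr K (hy.trans (by decide))
  have hm1m1 : ∀ y : box 2 1, (y : Site 2) = ![-1, -1] → twoPoint (nnXYCoupling K 2 (box 2 1)) (refCentre 2 1) y = blockGc K := by
    intro y hy
    have h := twoPoint_nnXY_box_refCentre_reflect K (⟨![-1, 1], by decide⟩ : box 2 1) 1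
    rw [hm11 (⟨![-1, 1], by decide⟩ : box 2 1) rfl] at h
    rw [← h]
    exact twoPoint_block_congr K (hy.trans (by decide))
  rcases hx with hx | hx | hx | hx
  · exact h11 x hx
  · exact hm11 x hx
  · exact h1m1 x hx
  · exact hm1m1 x hx

/-- The block two-point function at the foot of a site of `ℤ²`: `y ↦ G(pullIn 1 y)`. [cite: Lieb1980, p. 128 (boxes)] -/
private def footG (K : ℝ) (y : Site 2) : ℝ :=
  twoPoint (nnXYCoupling K 2 (box 2 1)) (refCentre 2 1) ⟨pullIn 1 y, pullIn_mem_box 1 y⟩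

omit [MeasurableSpace Circle] [BorelSpace Circle] in
/-- A sum over the box `[−L, L]²` is a double sum. [folklore] -/
private theorem sum_box_two (L : ℕ) (F : Site 2 → ℝ) :
    ∑ y ∈ box 2 L, F y = ∑ a ∈ Finset.Icc (-(L : ℤ)) L, ∑ b ∈ Finset.Icc (-(L : ℤ)) L, F ![a, b] := by
  rw [← Finset.sum_product']
  refine Finset.sum_nbij' (fun y => (y 0, y 1)) (fun p => ![p.1, p.2]) ?_ ?_ ?_ ?_ ?_
  · intro y hy
    rw [mem_box] at hy
    simp only [Finset.mem_product, Finset.mem_Icc]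
    exact ⟨⟨(hy 0).1, (hy 0).2⟩, ⟨(hy 1).1, (hy 1).2⟩⟩
  · intro p hp
    simp only [Finset.mem_product, Finset.mem_Icc] at hp
    rw [mem_box]
    intro i
    fin_cases i <;> simp [hp.1.1, hp.1.2, hp.2.1, hp.2.2]
  · intro y _
    funext i; fin_cases i <;> rfl
  · intro p _
    simp
  · intro y _
    congr 1
    funext i; fin_cases i <;> rfl

/-- `⟨cos(θ_a − θ_a)⟩ = 1`. [folklore] -/
private theorem twoPoint_self' {V : Type*} [Fintype V] (J : V × V → ℝ) (a : V) : twoPoint J a a = 1 := by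
  unfold twoPoint ginibreExpect
  have h1 : ∀ θ : V → Circle, cosDiff a a θ = 1 := fun θ => by
    rw [cosDiff, ← Complex.normSq_eq_conj_mul_self, Complex.ofReal_re, Circle.normSq_coe]
  simp_rw [h1, one_mul]
  exact div_self (integral_exp_pos (integrable_torusHaar_of_continuous (continuous_ginibreWeight _ _))).ne'

/-- The face sites of the `5 × 5` box and their feet (a finite check, `decide`). [cite: Lieb1980, p. 128 (boxes)] -/
private theorem face_values (K : ℝ) :
    (if Site.supNorm (![-2, -2] : Site 2) = 2 ∧ l1Norm (pullIn 1 (![-2, -2] : Site 2) - ![-2, -2]) = 1 then footG K ![-2, -2] else 0) = 0 ∧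
    (if Site.supNorm (![-2, -1] : Site 2) = 2 ∧ l1Norm (pullIn 1 (![-2, -1] : Site 2) - ![-2, -1]) = 1 then footG K ![-2, -1] else 0) = blockGc K ∧
    (if Site.supNorm (![-2, 0] : Site 2) = 2 ∧ l1Norm (pullIn 1 (![-2, 0] : Site 2) - ![-2, 0]) = 1 then footG K ![-2, 0] else 0) = blockGe K ∧
    (if Site.supNorm (![-2, 1] : Site 2) = 2 ∧ l1Norm (pullIn 1 (![-2, 1] : Site 2) - ![-2, 1]) = 1 then footG K ![-2, 1] else 0) = blockGc K ∧
    (if Site.supNorm (![-2, 2] : Site 2) = 2 ∧ l1Norm (pullIn 1 (![-2, 2] : Site 2) - ![-2, 2]) = 1 then footG K ![-2, 2] else 0) = 0 ∧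
    (if Site.supNorm (![-1, -2] : Site 2) = 2 ∧ l1Norm (pullIn 1 (![-1, -2] : Site 2) - ![-1, -2]) = 1 then footG K ![-1, -2] else 0) = blockGc K ∧
    (if Site.supNorm (![-1, -1] : Site 2) = 2 ∧ l1Norm (pullIn 1 (![-1, -1] : Site 2) - ![-1, -1]) = 1 then footG K ![-1, -1] else 0) = 0 ∧
    (if Site.supNorm (![-1, 0] : Site 2) = 2 ∧ l1Norm (pullIn 1 (![-1, 0] : Site 2) - ![-1, 0]) = 1 then footG K ![-1, 0] else 0) = 0 ∧
    (if Site.supNorm (![-1, 1] : Site 2) = 2 ∧ l1Norm (pullIn 1 (![-1, 1] : Site 2) - ![-1, 1]) = 1 then footG K ![-1, 1] else 0) = 0 ∧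
    (if Site.supNorm (![-1, 2] : Site 2) = 2 ∧ l1Norm (pullIn 1 (![-1, 2] : Site 2) - ![-1, 2]) = 1 then footG K ![-1, 2] else 0) = blockGc K ∧
    (if Site.supNorm (![0, -2] : Site 2) = 2 ∧ l1Norm (pullIn 1 (![0, -2] : Site 2) - ![0, -2]) = 1 then footG K ![0, -2] else 0) = blockGe K ∧
    (if Site.supNorm (![0, -1] : Site 2) = 2 ∧ l1Norm (pullIn 1 (![0, -1] : Site 2) - ![0, -1]) = 1 then footG K ![0, -1] else 0) = 0 ∧
    (if Site.supNorm (![0, 0] : Site 2) = 2 ∧ l1Norm (pullIn 1 (![0, 0] : Site 2) - ![0, 0]) = 1 then footG K ![0, 0] else 0) = 0 ∧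
    (if Site.supNorm (![0, 1] : Site 2) = 2 ∧ l1Norm (pullIn 1 (![0, 1] : Site 2) - ![0, 1]) = 1 then footG K ![0, 1] else 0) = 0 ∧
    (if Site.supNorm (![0, 2] : Site 2) = 2 ∧ l1Norm (pullIn 1 (![0, 2] : Site 2) - ![0, 2]) = 1 then footG K ![0, 2] else 0) = blockGe K ∧
    (if Site.supNorm (![1, -2] : Site 2) = 2 ∧ l1Norm (pullIn 1 (![1, -2] : Site 2) - ![1, -2]) = 1 then footG K ![1, -2] else 0) = blockGc K ∧
    (if Site.supNorm (![1, -1] : Site 2) = 2 ∧ l1Norm (pullIn 1 (![1, -1] : Site 2) - ![1, -1]) = 1 then footG K ![1, -1] else 0) = 0 ∧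
    (if Site.supNorm (![1, 0] : Site 2) = 2 ∧ l1Norm (pullIn 1 (![1, 0] : Site 2) - ![1, 0]) = 1 then footG K ![1, 0] else 0) = 0 ∧
    (if Site.supNorm (![1, 1] : Site 2) = 2 ∧ l1Norm (pullIn 1 (![1, 1] : Site 2) - ![1, 1]) = 1 then footG K ![1, 1] else 0) = 0 ∧
    (if Site.supNorm (![1, 2] : Site 2) = 2 ∧ l1Norm (pullIn 1 (![1, 2] : Site 2) - ![1, 2]) = 1 then footG K ![1, 2] else 0) = blockGc K ∧
    (if Site.supNorm (![2, -2] : Site 2) = 2 ∧ l1Norm (pullIn 1 (![2, -2] : Site 2) - ![2, -2]) = 1 then footG K ![2, -2] else 0) = 0 ∧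
    (if Site.supNorm (![2, -1] : Site 2) = 2 ∧ l1Norm (pullIn 1 (![2, -1] : Site 2) - ![2, -1]) = 1 then footG K ![2, -1] else 0) = blockGc K ∧
    (if Site.supNorm (![2, 0] : Site 2) = 2 ∧ l1Norm (pullIn 1 (![2, 0] : Site 2) - ![2, 0]) = 1 then footG K ![2, 0] else 0) = blockGe K ∧
    (if Site.supNorm (![2, 1] : Site 2) = 2 ∧ l1Norm (pullIn 1 (![2, 1] : Site 2) - ![2, 1]) = 1 then footG K ![2, 1] else 0) = blockGc K ∧
    (if Site.supNorm (![2, 2] : Site 2) = 2 ∧ l1Norm (pullIn 1 (![2, 2] : Site 2) - ![2, 2]) = 1 then footG K ![2, 2] else 0) = 0 := by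
  refine ⟨?_, ?_, ?_, ?_, ?_, ?_, ?_, ?_, ?_, ?_, ?_, ?_, ?_, ?_, ?_, ?_, ?_, ?_, ?_, ?_, ?_, ?_, ?_, ?_, ?_⟩
  · rw [if_neg (by decide)]
  · rw [if_pos (by decide)]
    have h : ((⟨pullIn 1 (![-2, -1] : Site 2), pullIn_mem_box 1 _⟩ : box 2 1) : Site 2) = ![-1, -1] := by decide
    exact twoPoint_block_eq_blockGc K _ (Or.inr (Or.inr (Or.inr h)))
  · rw [if_pos (by decide)]
    have h : ((⟨pullIn 1 (![-2, 0] : Site 2), pullIn_mem_box 1 _⟩ : box 2 1) : Site 2) = ![-1, 0] := by decide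
    exact twoPoint_block_eq_blockGe K _ (Or.inr (Or.inl h))
  · rw [if_pos (by decide)]
    have h : ((⟨pullIn 1 (![-2, 1] : Site 2), pullIn_mem_box 1 _⟩ : box 2 1) : Site 2) = ![-1, 1] := by decide
    exact twoPoint_block_eq_blockGc K _ (Or.inr (Or.inl h))
  · rw [if_neg (by decide)]
  · rw [if_pos (by decide)]
    have h : ((⟨pullIn 1 (![-1, -2] : Site 2), pullIn_mem_box 1 _⟩ : box 2 1) : Site 2) = ![-1, -1] := by decide
    exact twoPoint_block_eq_blockGc K _ (Or.inr (Or.inr (Or.inr h)))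
  · rw [if_neg (by decide)]
  · rw [if_neg (by decide)]
  · rw [if_neg (by decide)]
  · rw [if_pos (by decide)]
    have h : ((⟨pullIn 1 (![-1, 2] : Site 2), pullIn_mem_box 1 _⟩ : box 2 1) : Site 2) = ![-1, 1] := by decide
    exact twoPoint_block_eq_blockGc K _ (Or.inr (Or.inl h))
  · rw [if_pos (by decide)]
    have h : ((⟨pullIn 1 (![0, -2] : Site 2), pullIn_mem_box 1 _⟩ : box 2 1) : Site 2) = ![0, -1] := by decide
    exact twoPoint_block_eq_blockGe K _ (Or.inr (Or.inr (Or.inr h)))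
  · rw [if_neg (by decide)]
  · rw [if_neg (by decide)]
  · rw [if_neg (by decide)]
  · rw [if_pos (by decide)]
    have h : ((⟨pullIn 1 (![0, 2] : Site 2), pullIn_mem_box 1 _⟩ : box 2 1) : Site 2) = ![0, 1] := by decide
    exact twoPoint_block_eq_blockGe K _ (Or.inr (Or.inr (Or.inl h)))
  · rw [if_pos (by decide)]
    have h : ((⟨pullIn 1 (![1, -2] : Site 2), pullIn_mem_box 1 _⟩ : box 2 1) : Site 2) = ![1, -1] := by decide
    exact twoPoint_block_eq_blockGc K _ (Or.inr (Or.inr (Or.inl h)))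
  · rw [if_neg (by decide)]
  · rw [if_neg (by decide)]
  · rw [if_neg (by decide)]
  · rw [if_pos (by decide)]
    have h : ((⟨pullIn 1 (![1, 2] : Site 2), pullIn_mem_box 1 _⟩ : box 2 1) : Site 2) = ![1, 1] := by decide
    exact twoPoint_block_eq_blockGc K _ (Or.inl h)
  · rw [if_neg (by decide)]
  · rw [if_pos (by decide)]
    have h : ((⟨pullIn 1 (![2, -1] : Site 2), pullIn_mem_box 1 _⟩ : box 2 1) : Site 2) = ![1, -1] := by decide
    exact twoPoint_block_eq_blockGc K _ (Or.inr (Or.inr (Or.inl h)))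
  · rw [if_pos (by decide)]
    have h : ((⟨pullIn 1 (![2, 0] : Site 2), pullIn_mem_box 1 _⟩ : box 2 1) : Site 2) = ![1, 0] := by decide
    exact twoPoint_block_eq_blockGe K _ (Or.inl h)
  · rw [if_pos (by decide)]
    have h : ((⟨pullIn 1 (![2, 1] : Site 2), pullIn_mem_box 1 _⟩ : box 2 1) : Site 2) = ![1, 1] := by decide
    exact twoPoint_block_eq_blockGc K _ (Or.inl h)
  · rw [if_neg (by decide)]

/-- **Lieb's number of the two-dimensional nearest-neighbour XY model at `R = 2`, explicitly**:
`S_2(K) = u(K)·(4G_e(K) + 8G_c(K))`, `u = I₁/I₀` — the twelve face sites of the shell of the `5 × 5` box hang on the eight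
boundary sites of the free `3 × 3` block (edge midpoints once, corners twice), the four box corners are free rotators.
With `twoPoint_nn_le_pow_boxShellSum` (`ν = 2`, `R = 2`): `u(K)(4G_e + 8G_c) < 1` certifies `K < K_c^{XY}(ℤ²)`.
[cite: Lieb1980, Theorem 4 and p. 128 (boxes; finite algorithm)] -/
theorem nnBoxShellSum_two_two (K : ℝ) :
    nnBoxShellSum K 2 2 = besselRatio K * (4 * blockGe K + 8 * blockGc K) := by
  have h : nnBoxShellSum K 2 2 = besselRatio K *
      ∑ b ∈ (refShell 2 2).filter (fun b : box 2 2 => l1Norm (pullIn 1 (b : Site 2) - (b : Site 2)) = 1),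
        twoPoint (nnXYCoupling K 2 (box 2 1)) (refCentre 2 1) (footIn 1 b) := nnBoxShellSum_succ K 2 1
  rw [h]
  congr 1
  have e1 : (∑ b ∈ (refShell 2 2).filter (fun b : box 2 2 => l1Norm (pullIn 1 (b : Site 2) - (b : Site 2)) = 1),
        twoPoint (nnXYCoupling K 2 (box 2 1)) (refCentre 2 1) (footIn 1 b)) =
      ∑ b : box 2 2, (fun y : Site 2 =>
        if Site.supNorm y = 2 ∧ l1Norm (pullIn 1 y - y) = 1 then footG K y else 0) (b : Site 2) := by
    rw [refShell, Finset.filter_filter, Finset.sum_filter]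
    rfl
  rw [e1, Finset.sum_coe_sort (box 2 2)
    (fun y : Site 2 => if Site.supNorm y = 2 ∧ l1Norm (pullIn 1 y - y) = 1 then footG K y else 0),
    sum_box_two 2, show Finset.Icc (-((2 : ℕ) : ℤ)) (2 : ℕ) = {-2, -1, 0, 1, 2} by decide]
  have n1 : (-2 : ℤ) ∉ ({-1, 0, 1, 2} : Finset ℤ) := by decide
  have n2 : (-1 : ℤ) ∉ ({0, 1, 2} : Finset ℤ) := by decide
  have n3 : (0 : ℤ) ∉ ({1, 2} : Finset ℤ) := by decide
  have n4 : (1 : ℤ) ∉ ({2} : Finset ℤ) := by decide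
  simp only [Finset.sum_insert n1, Finset.sum_insert n2, Finset.sum_insert n3, Finset.sum_insert n4, Finset.sum_singleton]
  obtain ⟨v0, v1, v2, v3, v4, v5, v6, v7, v8, v9, v10, v11, v12, v13, v14, v15, v16, v17, v18, v19, v20, v21, v22, v23, v24⟩ := face_values K
  rw [v0, v1, v2, v3, v4, v5, v6, v7, v8, v9, v10, v11, v12, v13, v14, v15, v16, v17, v18, v19, v20, v21, v22, v23, v24]
  ring

/-- The nine sites of the `3 × 3` block and their two-point functions with the centre (a finite check). [cite: Lieb1980, p. 128 (boxes)] -/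
private theorem block_values (K : ℝ) :
    footG K ![-1, -1] = blockGc K ∧
    footG K ![-1, 0] = blockGe K ∧
    footG K ![-1, 1] = blockGc K ∧
    footG K ![0, -1] = blockGe K ∧
    footG K ![0, 0] = 1 ∧
    footG K ![0, 1] = blockGe K ∧
    footG K ![1, -1] = blockGc K ∧
    footG K ![1, 0] = blockGe K ∧
    footG K ![1, 1] = blockGc K := by
  refine ⟨?_, ?_, ?_, ?_, ?_, ?_, ?_, ?_, ?_⟩
  · unfold footG
    have h : ((⟨pullIn 1 (![-1, -1] : Site 2), pullIn_mem_box 1 _⟩ : box 2 1) : Site 2) = ![-1, -1] := by decide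
    exact twoPoint_block_eq_blockGc K _ (Or.inr (Or.inr (Or.inr h)))
  · unfold footG
    have h : ((⟨pullIn 1 (![-1, 0] : Site 2), pullIn_mem_box 1 _⟩ : box 2 1) : Site 2) = ![-1, 0] := by decide
    exact twoPoint_block_eq_blockGe K _ (Or.inr (Or.inl h))
  · unfold footG
    have h : ((⟨pullIn 1 (![-1, 1] : Site 2), pullIn_mem_box 1 _⟩ : box 2 1) : Site 2) = ![-1, 1] := by decide
    exact twoPoint_block_eq_blockGc K _ (Or.inr (Or.inl h))
  · unfold footG
    have h : ((⟨pullIn 1 (![0, -1] : Site 2), pullIn_mem_box 1 _⟩ : box 2 1) : Site 2) = ![0, -1] := by decide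
    exact twoPoint_block_eq_blockGe K _ (Or.inr (Or.inr (Or.inr h)))
  · unfold footG
    have h : ((⟨pullIn 1 (![0, 0] : Site 2), pullIn_mem_box 1 _⟩ : box 2 1) : Site 2) = (refCentre 2 1 : Site 2) := by decide
    rw [twoPoint_block_congr K h]
    exact twoPoint_self' _ _
  · unfold footG
    have h : ((⟨pullIn 1 (![0, 1] : Site 2), pullIn_mem_box 1 _⟩ : box 2 1) : Site 2) = ![0, 1] := by decide
    exact twoPoint_block_eq_blockGe K _ (Or.inr (Or.inr (Or.inl h)))
  · unfold footG
    have h : ((⟨pullIn 1 (![1, -1] : Site 2), pullIn_mem_box 1 _⟩ : box 2 1) : Site 2) = ![1, -1] := by decide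
    exact twoPoint_block_eq_blockGc K _ (Or.inr (Or.inr (Or.inl h)))
  · unfold footG
    have h : ((⟨pullIn 1 (![1, 0] : Site 2), pullIn_mem_box 1 _⟩ : box 2 1) : Site 2) = ![1, 0] := by decide
    exact twoPoint_block_eq_blockGe K _ (Or.inl h)
  · unfold footG
    have h : ((⟨pullIn 1 (![1, 1] : Site 2), pullIn_mem_box 1 _⟩ : box 2 1) : Site 2) = ![1, 1] := by decide
    exact twoPoint_block_eq_blockGc K _ (Or.inl h)
/-- **The interior susceptibility of the centre at `R = 2`, explicitly**: `χ^{int}_2(K) = 1 + 4G_e(K) + 4G_c(K)` (the nine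
sites of the free `3 × 3` block: centre, four edge midpoints, four corners) — the second input of `slabShellSum_le_box2D`
at `R = 2`. [cite: Lieb1980, p. 128 (boxes)] -/
theorem boxInteriorSum_two (K : ℝ) : boxInteriorSum K 2 = 1 + 4 * blockGe K + 4 * blockGc K := by
  have h : boxInteriorSum K 2 = ∑ x : box 2 1, twoPoint (nnXYCoupling K 2 (box 2 1)) (refCentre 2 1) x :=
    boxInteriorSum_succ K 1
  have e1 : (∑ x : box 2 1, twoPoint (nnXYCoupling K 2 (box 2 1)) (refCentre 2 1) x) =
      ∑ x : box 2 1, footG K (x : Site 2) := by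
    refine Finset.sum_congr rfl fun x _ => ?_
    unfold footG
    exact twoPoint_block_congr K (pullIn_of_supNorm_le (mem_box_iff_supNorm_le.1 x.2)).symm
  rw [h, e1, Finset.sum_coe_sort (box 2 1) (footG K), sum_box_two 1,
    show Finset.Icc (-((1 : ℕ) : ℤ)) (1 : ℕ) = {-1, 0, 1} by decide]
  have n2 : (-1 : ℤ) ∉ ({0, 1} : Finset ℤ) := by decide
  have n3 : (0 : ℤ) ∉ ({1} : Finset ℤ) := by decide
  simp only [Finset.sum_insert n2, Finset.sum_insert n3, Finset.sum_singleton]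
  obtain ⟨w0, w1, w2, w3, w4, w5, w6, w7, w8⟩ := block_values K
  rw [w0, w1, w2, w3, w4, w5, w6, w7, w8]
  ring

end ThreeByThree

end PlaneRotator

end Literature.Probability.LatticeModels

end
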